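import Mathlib
import HarnessLib
import Summits.Ventures.LatticeQCDFlow.Exactness.NCMCGeneralSpaceOccupancyChainMixing
import Summits.Ventures.LatticeQCDFlow.Scoring.SectorLinearLaw

/-!
# Certified error bars for the NCMC lane: the occupancy autocorrelation decays like `(1 − ε)^{⌊t/2⌋}`, `τ_int(occupancy) ≤ 1/2 + (2/ε − 1)/(1 − σ)`, and `Var p̂_n`, `P(|dF_occ − ΔF| ≥ η)` are bounded

HONEST FRAMING: exact (Metropolis-corrected) sampling algorithms for lattice gauge theory;
figures of merit are autocorrelation/cost numbers at stated couplings and volumes; no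
continuum-physics claim.

Venture `LatticeQCDFlow` (cell pub-lqcd), topic `Exactness`; FANOUT row 13 (`eng-snf`, GEN-18).
NEW WORK of the cell, not a published result; no definition is introduced; nothing is cited as a
fact.  Inputs: GEN-18's two-step minorisation of `Q = switchKernel κF κR c W s e ∘ₖ levelKernel T₀ T₁`
(`…OccupancyChainDoeblin`, `…Mixing`), the `m`-step envelope of `NCMCGeneralSpaceDoeblinPower`,
GEN-17's EXACT identity `variance_occupancy_chain` (`Var p̂_n = 2 τ_n(ρ_occ) σ(1 − σ)/n`), row 8's
two-time law (`Scoring.chain_covariance`, `autocov_centredIndicator_eq_stayMass`), row 9's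
`setAutocov` / `setACF`.  Engine: `latflow-snf`, `correction = ncmc-metropolis`; `σ = σ(c − ΔF)`.

## Content

* §1 helpers: `tauIntN_le_half_add_sum_abs`, `sum_range_pow_succ_div_le`,
  `tauIntN_le_of_abs_le_pow_div` (`|ρ t| ≤ M x^{⌊t/m⌋}` for `t ≥ 1` ⇒ `τ_N ≤ 1/2 + M (m/(1−x) − 1)`);
  `log_sigmoid_div`, `sigmoid_logit`, **`le_abs_sub_of_le_abs_logit_sub`** (a deviation `≥ η` of
  `logit p̂` from `u` forces a deviation `≥ δ_η = min(σ(u+η) − σ(u), σ(u) − σ(u−η))` of `p̂`).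
* §2 `chain_cov_indicator_eq_setAutocov` — for ANY Markov kernel with invariant probability law:
  the stationary covariance `cov(1_A(X_0), 1_A(X_t))` of the chain IS row 9's `setAutocov κ π t A A`
  (row 8's `chain_covariance` + `autocov_centredIndicator_eq_stayMass` + `setAutocov_eq_setIntegral`).
* §3 for ANY two-step minorisation `ε • ν ≤ nHit Q 2 z` of the NCMC iteration kernel of a Crooks pair
  with invariant level samplers: **`CrooksPair.ncmc_abs_occupancyACF_le_of_sq`**
  (`|ρ_occ(t)| ≤ (1 − ε)^{⌊t/2⌋}/(1 − σ)`), **`CrooksPair.ncmc_tauInt_occupancy_le_of_sq`**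
  (`τ_int(ρ_occ) ≤ 1/2 + (2/ε − 1)/(1 − σ)` in the scorers' `tauInt`),
  **`CrooksPair.ncmc_variance_occupancy_le_of_sq`** (`Var_π p̂_n ≤ 2 (1/2 + (2/ε − 1)/(1 − σ)) σ(1 − σ)/n`
  — GEN-17's exact `2 τ_n σ(1 − σ)/n` with `τ_n` now BOUNDED), **`CrooksPair.ncmc_occupancy_deviation_le_of_sq`**
  (Chebyshev: `P_π(|p̂_n − σ| ≥ δ) ≤ bound/δ²`), **`CrooksPair.ncmc_dFocc_deviation_le_of_sq`**
  (`P_π(|dF_occ,n − ΔF| ≥ η) ≤ bound/δ_η²`): an honest, certified, non-asymptotic error statement for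
  the engine's `dF_occ` at every run length `n`, in equilibrium.

NOT CLAIMED: the constant is the Doeblin one (astronomically weak on a real lattice; the measured
`τ_int` stays the figure of merit); non-stationary starts (burn-in: `…Mixing`); a CLT-width interval.
-/

namespace Summit.Ventures.LatticeQCDFlow.Exactness.GeneralNCMC

open MeasureTheory ProbabilityTheory Set Filter Finset
open scoped ENNReal Topology

/-! ## §1 Helpers: `τ_N` under an `m`-step envelope; `logit` and `σ` -/

section Helpers

/-- `τ_N(ρ) ≤ 1/2 + Σ_{t=1}^{N} |ρ t|` (the Fejér weights are in `[0, 1]`). -/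
theorem tauIntN_le_half_add_sum_abs (ρ : ℕ → ℝ) (N : ℕ) :
    Scoring.tauIntN ρ N ≤ 1 / 2 + ∑ t ∈ range N, |ρ (t + 1)| := by
  unfold Scoring.tauIntN
  refine add_le_add le_rfl (Finset.sum_le_sum fun t ht => ?_)
  have hN : (0 : ℝ) < N := by exact_mod_cast Nat.lt_of_le_of_lt (Nat.zero_le t) (mem_range.1 ht)
  have ht' : (t : ℝ) + 1 ≤ N := by exact_mod_cast Nat.succ_le_of_lt (mem_range.1 ht)
  have hw0 : 0 ≤ 1 - ((t : ℝ) + 1) / N := by rw [sub_nonneg, div_le_one hN]; exact ht'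
  have hw1 : 1 - ((t : ℝ) + 1) / N ≤ 1 := by
    have : 0 ≤ ((t : ℝ) + 1) / N := by positivity
    linarith
  calc (1 - ((t : ℝ) + 1) / N) * ρ (t + 1) ≤ |(1 - ((t : ℝ) + 1) / N) * ρ (t + 1)| := le_abs_self _
    _ = (1 - ((t : ℝ) + 1) / N) * |ρ (t + 1)| := by rw [abs_mul, abs_of_nonneg hw0]
    _ ≤ 1 * |ρ (t + 1)| := mul_le_mul_of_nonneg_right hw1 (abs_nonneg _)
    _ = |ρ (t + 1)| := one_mul _

/-- `Σ_{t<N} x^{⌊(t+1)/m⌋} ≤ m/(1 − x) − 1` (`0 ≤ x < 1`, `m ≥ 1`; the dropped `t = 0` term is `1`). -/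
theorem sum_range_pow_succ_div_le {x : ℝ} {m : ℕ} (hm : 0 < m) (hx0 : 0 ≤ x) (hx1 : x < 1) (N : ℕ) :
    ∑ t ∈ range N, x ^ ((t + 1) / m) ≤ m / (1 - x) - 1 := by
  have h := Scoring.sum_range_pow_div_le hm hx0 hx1 (N + 1)
  rw [Finset.sum_range_succ' (fun t => x ^ (t / m)) N, Nat.zero_div, pow_zero] at h
  linarith

/-- **`τ_N` under an `m`-step geometric envelope**: `|ρ t| ≤ M x^{⌊t/m⌋}` for `t ≥ 1` (`0 ≤ M`,
`0 ≤ x < 1`, `m ≥ 1`) ⇒ `τ_N(ρ) ≤ 1/2 + M (m/(1 − x) − 1)` for every `N`. -/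
theorem tauIntN_le_of_abs_le_pow_div {ρ : ℕ → ℝ} {M x : ℝ} {m : ℕ} (hm : 0 < m) (hM : 0 ≤ M)
    (hx0 : 0 ≤ x) (hx1 : x < 1) (hρ : ∀ t, 1 ≤ t → |ρ t| ≤ M * x ^ (t / m)) (N : ℕ) :
    Scoring.tauIntN ρ N ≤ 1 / 2 + M * (m / (1 - x) - 1) := by
  calc Scoring.tauIntN ρ N ≤ 1 / 2 + ∑ t ∈ range N, |ρ (t + 1)| := tauIntN_le_half_add_sum_abs ρ N
    _ ≤ 1 / 2 + ∑ t ∈ range N, M * x ^ ((t + 1) / m) :=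
        add_le_add le_rfl
          (Finset.sum_le_sum fun t _ => hρ (t + 1) (Nat.succ_le_succ (Nat.zero_le _)))
    _ = 1 / 2 + M * ∑ t ∈ range N, x ^ ((t + 1) / m) := by rw [Finset.mul_sum]
    _ ≤ 1 / 2 + M * (m / (1 - x) - 1) :=
        add_le_add le_rfl (mul_le_mul_of_nonneg_left (sum_range_pow_succ_div_le hm hx0 hx1 N) hM)

/-- `logit(σ(u)) = u`: `log(σ(u)/(1 − σ(u))) = u`. -/
theorem log_sigmoid_div (u : ℝ) : Real.log (Real.sigmoid u / (1 - Real.sigmoid u)) = u := by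
  rw [← Real.sigmoid_neg]
  have hratio : Real.sigmoid u / Real.sigmoid (-u) = Real.exp u := by
    rw [div_eq_iff (Real.sigmoid_pos _).ne', ← Real.sigmoid_mul_rexp_neg u, Real.exp_neg]
    field_simp
  rw [hratio, Real.log_exp]

/-- `σ(logit(p)) = p` for `p ∈ (0, 1)`. -/
theorem sigmoid_logit {p : ℝ} (h0 : 0 < p) (h1 : p < 1) :
    Real.sigmoid (Real.log (p / (1 - p))) = p := by
  have h1' : 0 < 1 - p := sub_pos.2 h1
  rw [Real.sigmoid_def, Real.exp_neg, Real.exp_log (div_pos h0 h1'), inv_div]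
  field_simp
  ring

/-- **Deviations of `logit p̂` force deviations of `p̂`.**  With `s = σ(u)` and
`δ = min(σ(u + η) − s, s − σ(u − η))`: if `η ≤ |u − logit(p̂)|` then `δ ≤ |p̂ − s|`
(contrapositive: `|p̂ − s| < δ` puts `p̂` in `(σ(u−η), σ(u+η)) ⊂ (0,1)`, and `logit` is increasing). -/
theorem le_abs_sub_of_le_abs_logit_sub {p u η : ℝ} (h : η ≤ |u - Real.log (p / (1 - p))|) :
    min (Real.sigmoid (u + η) - Real.sigmoid u) (Real.sigmoid u - Real.sigmoid (u - η)) ≤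
      |p - Real.sigmoid u| := by
  by_contra hlt
  rw [not_le] at hlt
  have hlo : Real.sigmoid (u - η) < p := by
    have := (abs_sub_lt_iff.1 (hlt.trans_le (min_le_right _ _))).2
    linarith
  have hhi : p < Real.sigmoid (u + η) := by
    have := (abs_sub_lt_iff.1 (hlt.trans_le (min_le_left _ _))).1
    linarith
  have hp0 : 0 < p := (Real.sigmoid_pos _).trans hlo
  have hp1 : p < 1 := hhi.trans (Real.sigmoid_lt_one _)
  have hl : u - η < Real.log (p / (1 - p)) := by
    rw [← Real.sigmoid_lt_iff, sigmoid_logit hp0 hp1]; exact hlo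
  have hu : Real.log (p / (1 - p)) < u + η := by
    rw [← Real.sigmoid_lt_iff, sigmoid_logit hp0 hp1]; exact hhi
  have habs : |u - Real.log (p / (1 - p))| < η := abs_sub_lt_iff.2 ⟨by linarith, by linarith⟩
  exact absurd h (not_le.2 habs)

end Helpers

/-! ## §2 The stationary covariance of an event indicator along a chain is `setAutocov` -/

section ChainCov

variable {S : Type*} [MeasurableSpace S] (κ : Kernel S S) [IsMarkovKernel κ] {π : Measure S}
  [IsProbabilityMeasure π]

/-- **The two dictionaries agree**: for a Markov kernel with invariant probability law `π`, the
stationary covariance of `1_A(X_0)` and `1_A(X_t)` along the chain (Mathlib `Kernel.trajMeasure`,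
`ProbabilityTheory.covariance`) is row 9's `setAutocov κ π t A A`. -/
theorem chain_cov_indicator_eq_setAutocov (hπ : Kernel.Invariant κ π) {A : Set S}
    (hA : MeasurableSet A) (t : ℕ) :
    cov[fun x : ℕ → S => A.indicator (1 : S → ℝ) (x 0), fun x : ℕ → S => A.indicator (1 : S → ℝ) (x t);
      Kernel.trajMeasure (X := fun _ : ℕ => S) π
        (fun n : ℕ => κ.comap (fun h : (i : ↥(Finset.Iic n)) → S => h ⟨n, Finset.mem_Iic.2 le_rfl⟩)
          (measurable_pi_apply _))] = setAutocov κ π t A A := by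
  haveI := isMarkovKernel_nHit κ t
  have hf : Measurable (A.indicator (1 : S → ℝ)) := measurable_const.indicator hA
  have hC : ∀ x, |A.indicator (1 : S → ℝ) x| ≤ 1 := fun x => by
    by_cases hx : x ∈ A <;> simp [hx]
  rw [Scoring.chain_covariance hπ hf hC 0 t, Nat.dist_zero_left]
  simp_rw [integral_indicator_one hA]
  rw [Scoring.autocov_centredIndicator_eq_stayMass hπ hA t, setAutocov_eq_setIntegral t hA hA]
  have hmeas : Measurable fun x => (nHit κ t x).real A :=
    (Kernel.measurable_coe _ hA).ennreal_toReal
  have hint : Integrable (fun x => (nHit κ t x).real A) (π.restrict A) :=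
    (integrable_const (1 : ℝ)).mono' hmeas.aestronglyMeasurable
      (ae_of_all _ fun x => by
        rw [Real.norm_eq_abs, abs_of_nonneg measureReal_nonneg]
        exact measureReal_le_one)
  rw [integral_sub hint (integrable_const _), setIntegral_const, smul_eq_mul, sq]

end ChainCov

/-! ## §3 Error bars for the NCMC lane under a two-step minorisation -/

section ErrorBars

variable {Ω E : Type*} [MeasurableSpace Ω] [MeasurableSpace E]
  {ν₀ ν₁ : Measure Ω} [IsFiniteMeasure ν₀] [IsFiniteMeasure ν₁]
  {κF κR : Kernel Ω E} [IsMarkovKernel κF] [IsMarkovKernel κR] {s e : E → Ω} {W : E → ℝ} {c : ℝ}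
  {T₀ T₁ : Kernel Ω Ω} [IsMarkovKernel T₀] [IsMarkovKernel T₁] {ε : ℝ≥0∞}
  {ν : Measure (Bool × Ω)} [IsProbabilityMeasure ν]

/-- **THE OCCUPANCY AUTOCORRELATION DECAYS GEOMETRICALLY**: in equilibrium,
`|ρ_occ(t)| ≤ (1 − ε)^{⌊t/2⌋}/(1 − σ(c − ΔF))`, `ρ_occ = setACF Q π_c (target level)`. -/
theorem CrooksPair.ncmc_abs_occupancyACF_le_of_sq (h : CrooksPair ν₀ ν₁ κF κR s e W)
    (h0 : ν₀ univ ≠ 0) (h1 : ν₁ univ ≠ 0) (hT₀ : Kernel.Invariant T₀ ν₀)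
    (hT₁ : Kernel.Invariant T₁ ν₁)
    (hD : haveI := isMarkovKernel_switchKernel (κF := κF) (κR := κR) (c := c)
              h.measurable_W h.measurable_s h.measurable_e
      ∀ z, ε • ν ≤ nHit (switchKernel κF κR c W s e ∘ₖ levelKernel T₀ T₁) 2 z)
    {ΔF : ℝ} (hΔF : Real.exp (-ΔF) = ((ν₀ univ)⁻¹ * ν₁ univ).toReal) (t : ℕ) :
    haveI := isMarkovKernel_switchKernel (κF := κF) (κR := κR) (c := c)
      h.measurable_W h.measurable_s h.measurable_e
    haveI := isMarkovKernel_levelKernel T₀ T₁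
    |setACF (switchKernel κF κR c W s e ∘ₖ levelKernel T₀ T₁)
        ((jointWeight c ν₀ ν₁ univ)⁻¹ • jointWeight c ν₀ ν₁) (targetLevel Ω) t| ≤
      (1 - ε.toReal) ^ (t / 2) / (1 - Real.sigmoid (c - ΔF)) := by
  haveI := isMarkovKernel_switchKernel (κF := κF) (κR := κR) (c := c)
    h.measurable_W h.measurable_s h.measurable_e
  haveI := isMarkovKernel_levelKernel T₀ T₁
  haveI := isProbabilityMeasure_jointLaw c ν₀ ν₁ h0
  obtain ⟨x0, -⟩ := nonempty_of_measure_ne_zero h0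
  haveI : Nonempty (Bool × Ω) := ⟨(false, x0)⟩
  haveI := isMarkovKernel_nHit (switchKernel κF κR c W s e ∘ₖ levelKernel T₀ T₁) 2
  have hσ := jointLaw_real_targetLevel c ν₀ ν₁ h0 h1 hΔF
  have hb := abs_setACF_le_of_nHit (fun x B hB => minorised_setwise hD x hB)
    (eps_le_one_of_minorised hD) (invariant_smul _ (iteration_invariant h hT₀ hT₁ c) _)
    measurableSet_targetLevel (by rw [hσ]; exact Real.sigmoid_pos _)
    (by rw [hσ]; exact Real.sigmoid_lt_one _) t
  rwa [hσ] at hb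

/-- **THE INTEGRATED AUTOCORRELATION TIME OF THE OCCUPANCY IS FINITE AND BOUNDED**:
`τ_int(ρ_occ) ≤ 1/2 + (2/ε − 1)/(1 − σ(c − ΔF))` in the scorers' convention (`ε ≠ 0`). -/
theorem CrooksPair.ncmc_tauInt_occupancy_le_of_sq (h : CrooksPair ν₀ ν₁ κF κR s e W)
    (h0 : ν₀ univ ≠ 0) (h1 : ν₁ univ ≠ 0) (hT₀ : Kernel.Invariant T₀ ν₀)
    (hT₁ : Kernel.Invariant T₁ ν₁) (hε : ε ≠ 0)
    (hD : haveI := isMarkovKernel_switchKernel (κF := κF) (κR := κR) (c := c)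
              h.measurable_W h.measurable_s h.measurable_e
      ∀ z, ε • ν ≤ nHit (switchKernel κF κR c W s e ∘ₖ levelKernel T₀ T₁) 2 z)
    {ΔF : ℝ} (hΔF : Real.exp (-ΔF) = ((ν₀ univ)⁻¹ * ν₁ univ).toReal) :
    haveI := isMarkovKernel_switchKernel (κF := κF) (κR := κR) (c := c)
      h.measurable_W h.measurable_s h.measurable_e
    haveI := isMarkovKernel_levelKernel T₀ T₁
    Scoring.tauInt (setACF (switchKernel κF κR c W s e ∘ₖ levelKernel T₀ T₁)
        ((jointWeight c ν₀ ν₁ univ)⁻¹ • jointWeight c ν₀ ν₁) (targetLevel Ω)) ≤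
      1 / 2 + (2 / ε.toReal - 1) / (1 - Real.sigmoid (c - ΔF)) := by
  haveI := isMarkovKernel_switchKernel (κF := κF) (κR := κR) (c := c)
    h.measurable_W h.measurable_s h.measurable_e
  haveI := isMarkovKernel_levelKernel T₀ T₁
  haveI := isProbabilityMeasure_jointLaw c ν₀ ν₁ h0
  obtain ⟨x0, -⟩ := nonempty_of_measure_ne_zero h0
  haveI : Nonempty (Bool × Ω) := ⟨(false, x0)⟩
  haveI := isMarkovKernel_nHit (switchKernel κF κR c W s e ∘ₖ levelKernel T₀ T₁) 2
  have hσ := jointLaw_real_targetLevel c ν₀ ν₁ h0 h1 hΔF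
  have hb := tauInt_setACF_le_of_nHit (fun x B hB => minorised_setwise hD x hB)
    (pos_iff_ne_zero.2 hε) (eps_le_one_of_minorised hD) two_pos
    (invariant_smul _ (iteration_invariant h hT₀ hT₁ c) _)
    measurableSet_targetLevel (by rw [hσ]; exact Real.sigmoid_pos _)
    (by rw [hσ]; exact Real.sigmoid_lt_one _)
  rw [hσ, Nat.cast_ofNat] at hb
  exact hb

/-- **A CERTIFIED VARIANCE BOUND FOR THE REPORTED OCCUPANCY**: along the NCMC chain in equilibrium,
for every `n ≥ 1`, `Var p̂_n ≤ 2 (1/2 + (2/ε − 1)/(1 − σ)) · σ(1 − σ)/n` (`σ = σ(c − ΔF)`): GEN-17's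
exact identity `Var p̂_n = 2 τ_n(ρ_occ) σ(1 − σ)/n` with `τ_n` bounded by the minorisation. -/
theorem CrooksPair.ncmc_variance_occupancy_le_of_sq (h : CrooksPair ν₀ ν₁ κF κR s e W)
    (h0 : ν₀ univ ≠ 0) (h1 : ν₁ univ ≠ 0) (hT₀ : Kernel.Invariant T₀ ν₀)
    (hT₁ : Kernel.Invariant T₁ ν₁) (hε : ε ≠ 0)
    (hD : haveI := isMarkovKernel_switchKernel (κF := κF) (κR := κR) (c := c)
              h.measurable_W h.measurable_s h.measurable_e
      ∀ z, ε • ν ≤ nHit (switchKernel κF κR c W s e ∘ₖ levelKernel T₀ T₁) 2 z)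
    {ΔF : ℝ} (hΔF : Real.exp (-ΔF) = ((ν₀ univ)⁻¹ * ν₁ univ).toReal) {n : ℕ} (hn : n ≠ 0) :
    haveI := isMarkovKernel_switchKernel (κF := κF) (κR := κR) (c := c)
      h.measurable_W h.measurable_s h.measurable_e
    haveI := isMarkovKernel_levelKernel T₀ T₁
    Var[fun z : ℕ → Bool × Ω => (∑ i ∈ range n, (targetLevel Ω).indicator (1 : Bool × Ω → ℝ) (z i)) / n;
      Kernel.trajMeasure (X := fun _ : ℕ => Bool × Ω)
        ((jointWeight c ν₀ ν₁ univ)⁻¹ • jointWeight c ν₀ ν₁)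
        (fun n : ℕ => (switchKernel κF κR c W s e ∘ₖ levelKernel T₀ T₁).comap
          (fun hh : (j : ↥(Finset.Iic n)) → Bool × Ω => hh ⟨n, Finset.mem_Iic.2 le_rfl⟩)
          (measurable_pi_apply _))] ≤
      2 * (1 / 2 + (2 / ε.toReal - 1) / (1 - Real.sigmoid (c - ΔF))) *
        (Real.sigmoid (c - ΔF) * (1 - Real.sigmoid (c - ΔF))) / n := by
  haveI := isMarkovKernel_switchKernel (κF := κF) (κR := κR) (c := c)
    h.measurable_W h.measurable_s h.measurable_e
  haveI := isMarkovKernel_levelKernel T₀ T₁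
  haveI := isProbabilityMeasure_jointLaw c ν₀ ν₁ h0
  obtain ⟨x0, -⟩ := nonempty_of_measure_ne_zero h0
  haveI : Nonempty (Bool × Ω) := ⟨(false, x0)⟩
  haveI := isMarkovKernel_nHit (switchKernel κF κR c W s e ∘ₖ levelKernel T₀ T₁) 2
  set Q := switchKernel κF κR c W s e ∘ₖ levelKernel T₀ T₁ with hQ
  have hinv : Kernel.Invariant Q ((jointWeight c ν₀ ν₁ univ)⁻¹ • jointWeight c ν₀ ν₁) :=
    invariant_smul _ (iteration_invariant h hT₀ hT₁ c) _
  have hσ := jointLaw_real_targetLevel c ν₀ ν₁ h0 h1 hΔF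
  have hσ0 : 0 < Real.sigmoid (c - ΔF) := Real.sigmoid_pos _
  have hσ1 : 0 < 1 - Real.sigmoid (c - ΔF) := sub_pos.2 (Real.sigmoid_lt_one _)
  -- the exact identity of GEN-17
  rw [variance_occupancy_chain Q h0 h1 (iteration_invariant h hT₀ hT₁ c) hΔF hn]
  -- the autocorrelation in it is `setACF Q π_c (target level)`
  have hρ : (fun t => cov[fun z : ℕ → Bool × Ω => (targetLevel Ω).indicator (1 : Bool × Ω → ℝ) (z 0),
      fun z : ℕ → Bool × Ω => (targetLevel Ω).indicator (1 : Bool × Ω → ℝ) (z t);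
      Kernel.trajMeasure (X := fun _ : ℕ => Bool × Ω)
        ((jointWeight c ν₀ ν₁ univ)⁻¹ • jointWeight c ν₀ ν₁)
        (fun n : ℕ => Q.comap (fun hh : (j : ↥(Finset.Iic n)) → Bool × Ω =>
          hh ⟨n, Finset.mem_Iic.2 le_rfl⟩) (measurable_pi_apply _))] /
      (Real.sigmoid (c - ΔF) * (1 - Real.sigmoid (c - ΔF)))) =
      setACF Q ((jointWeight c ν₀ ν₁ univ)⁻¹ • jointWeight c ν₀ ν₁) (targetLevel Ω) := by
    funext t
    rw [setACF, chain_cov_indicator_eq_setAutocov Q hinv measurableSet_targetLevel t,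
      setAutocov_zero measurableSet_targetLevel, hσ]
  rw [hρ]
  -- bound `τ_n` by the envelope
  have hεtop : ε ≠ ∞ := ne_top_of_le_ne_top ENNReal.one_ne_top (eps_le_one_of_minorised hD)
  have hr0 : 0 ≤ 1 - ε.toReal := sub_nonneg.2 (ENNReal.toReal_le_of_le_ofReal zero_le_one
    (by simpa using eps_le_one_of_minorised hD))
  have hr1 : 1 - ε.toReal < 1 := sub_lt_self _ (ENNReal.toReal_pos hε hεtop)
  have henv : ∀ t, 1 ≤ t → |setACF Q ((jointWeight c ν₀ ν₁ univ)⁻¹ • jointWeight c ν₀ ν₁)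
      (targetLevel Ω) t| ≤ (1 - Real.sigmoid (c - ΔF))⁻¹ * (1 - ε.toReal) ^ (t / 2) := by
    intro t _
    rw [← div_eq_inv_mul]
    exact h.ncmc_abs_occupancyACF_le_of_sq h0 h1 hT₀ hT₁ hD hΔF t
  have hτ := tauIntN_le_of_abs_le_pow_div two_pos (inv_pos.2 hσ1).le hr0 hr1 henv n
  rw [sub_sub_cancel, Nat.cast_ofNat, ← div_eq_inv_mul] at hτ
  have hnpos : (0 : ℝ) < n := by exact_mod_cast Nat.pos_of_ne_zero hn
  refine div_le_div_of_nonneg_right ?_ hnpos.le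
  exact mul_le_mul_of_nonneg_right (mul_le_mul_of_nonneg_left hτ zero_le_two)
    (mul_pos hσ0 hσ1).le

/-- **CHEBYSHEV FOR THE OCCUPANCY**: in equilibrium, for every `n ≥ 1` and `δ > 0`,
`P_π(|p̂_n − σ| ≥ δ) ≤ (2 (1/2 + (2/ε − 1)/(1 − σ)) σ(1 − σ)/n) / δ²`. -/
theorem CrooksPair.ncmc_occupancy_deviation_le_of_sq (h : CrooksPair ν₀ ν₁ κF κR s e W)
    (h0 : ν₀ univ ≠ 0) (h1 : ν₁ univ ≠ 0) (hT₀ : Kernel.Invariant T₀ ν₀)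
    (hT₁ : Kernel.Invariant T₁ ν₁) (hε : ε ≠ 0)
    (hD : haveI := isMarkovKernel_switchKernel (κF := κF) (κR := κR) (c := c)
              h.measurable_W h.measurable_s h.measurable_e
      ∀ z, ε • ν ≤ nHit (switchKernel κF κR c W s e ∘ₖ levelKernel T₀ T₁) 2 z)
    {ΔF : ℝ} (hΔF : Real.exp (-ΔF) = ((ν₀ univ)⁻¹ * ν₁ univ).toReal) {n : ℕ} (hn : n ≠ 0)
    {δ : ℝ} (hδ : 0 < δ) :
    haveI := isMarkovKernel_switchKernel (κF := κF) (κR := κR) (c := c)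
      h.measurable_W h.measurable_s h.measurable_e
    haveI := isMarkovKernel_levelKernel T₀ T₁
    Kernel.trajMeasure (X := fun _ : ℕ => Bool × Ω)
        ((jointWeight c ν₀ ν₁ univ)⁻¹ • jointWeight c ν₀ ν₁)
        (fun n : ℕ => (switchKernel κF κR c W s e ∘ₖ levelKernel T₀ T₁).comap
          (fun hh : (j : ↥(Finset.Iic n)) → Bool × Ω => hh ⟨n, Finset.mem_Iic.2 le_rfl⟩)
          (measurable_pi_apply _))
      {z | δ ≤ |(∑ i ∈ range n, (targetLevel Ω).indicator (1 : Bool × Ω → ℝ) (z i)) / n -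
        Real.sigmoid (c - ΔF)|} ≤
      ENNReal.ofReal (2 * (1 / 2 + (2 / ε.toReal - 1) / (1 - Real.sigmoid (c - ΔF))) *
        (Real.sigmoid (c - ΔF) * (1 - Real.sigmoid (c - ΔF))) / n / δ ^ 2) := by
  haveI := isMarkovKernel_switchKernel (κF := κF) (κR := κR) (c := c)
    h.measurable_W h.measurable_s h.measurable_e
  haveI := isMarkovKernel_levelKernel T₀ T₁
  haveI := isProbabilityMeasure_jointLaw c ν₀ ν₁ h0
  set Q := switchKernel κF κR c W s e ∘ₖ levelKernel T₀ T₁ with hQ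
  set P := Kernel.trajMeasure (X := fun _ : ℕ => Bool × Ω)
    ((jointWeight c ν₀ ν₁ univ)⁻¹ • jointWeight c ν₀ ν₁)
    (fun n : ℕ => Q.comap (fun hh : (j : ↥(Finset.Iic n)) → Bool × Ω =>
      hh ⟨n, Finset.mem_Iic.2 le_rfl⟩) (measurable_pi_apply _)) with hP
  set X : (ℕ → Bool × Ω) → ℝ := fun z =>
    (∑ i ∈ range n, (targetLevel Ω).indicator (1 : Bool × Ω → ℝ) (z i)) / n with hX
  have hmean : P[X] = Real.sigmoid (c - ΔF) := by
    rw [hP, hX]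
    exact integral_occupancy_chain Q h0 h1 (iteration_invariant h hT₀ hT₁ c) hΔF hn
  have hXm : MemLp X 2 P := by
    refine MemLp.of_bound (((Finset.measurable_sum (range n) fun i _ =>
      (measurable_one.indicator measurableSet_targetLevel).comp (measurable_pi_apply i)).div_const
      _).aestronglyMeasurable) 1 (Eventually.of_forall fun z => ?_)
    rw [hX, Real.norm_eq_abs, abs_div, Nat.abs_cast]
    rcases Nat.eq_zero_or_pos n with hn0 | hnp
    · exact absurd hn0 hn
    have hnR : (0 : ℝ) < n := by exact_mod_cast hnp
    rw [div_le_one hnR]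
    calc |∑ i ∈ range n, (targetLevel Ω).indicator (1 : Bool × Ω → ℝ) (z i)|
        ≤ ∑ i ∈ range n, |(targetLevel Ω).indicator (1 : Bool × Ω → ℝ) (z i)| :=
          Finset.abs_sum_le_sum_abs _ _
      _ ≤ ∑ _i ∈ range n, (1 : ℝ) := Finset.sum_le_sum fun i _ => by
          by_cases hz : z i ∈ targetLevel Ω <;> simp [hz]
      _ = n := by rw [Finset.sum_const, Finset.card_range, nsmul_eq_mul, mul_one]
  have hcheb := meas_ge_le_variance_div_sq hXm hδ
  rw [hmean] at hcheb
  refine hcheb.trans (ENNReal.ofReal_le_ofReal (div_le_div_of_nonneg_right ?_ (sq_pos_of_pos hδ).le))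
  exact h.ncmc_variance_occupancy_le_of_sq h0 h1 hT₀ hT₁ hε hD hΔF hn

/-- **A CERTIFIED NON-ASYMPTOTIC ERROR STATEMENT FOR `dF_occ`**: in equilibrium, for every `n ≥ 1`
and `η > 0`, `P_π(|dF_occ,n − ΔF| ≥ η) ≤ (2 (1/2 + (2/ε − 1)/(1 − σ)) σ(1 − σ)/n) / δ_η²` with
`δ_η = min(σ(c − ΔF + η) − σ, σ − σ(c − ΔF − η)) > 0`, `σ = σ(c − ΔF)`. -/
theorem CrooksPair.ncmc_dFocc_deviation_le_of_sq (h : CrooksPair ν₀ ν₁ κF κR s e W)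
    (h0 : ν₀ univ ≠ 0) (h1 : ν₁ univ ≠ 0) (hT₀ : Kernel.Invariant T₀ ν₀)
    (hT₁ : Kernel.Invariant T₁ ν₁) (hε : ε ≠ 0)
    (hD : haveI := isMarkovKernel_switchKernel (κF := κF) (κR := κR) (c := c)
              h.measurable_W h.measurable_s h.measurable_e
      ∀ z, ε • ν ≤ nHit (switchKernel κF κR c W s e ∘ₖ levelKernel T₀ T₁) 2 z)
    {ΔF : ℝ} (hΔF : Real.exp (-ΔF) = ((ν₀ univ)⁻¹ * ν₁ univ).toReal) {n : ℕ} (hn : n ≠ 0)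
    {η : ℝ} (hη : 0 < η) :
    haveI := isMarkovKernel_switchKernel (κF := κF) (κR := κR) (c := c)
      h.measurable_W h.measurable_s h.measurable_e
    haveI := isMarkovKernel_levelKernel T₀ T₁
    Kernel.trajMeasure (X := fun _ : ℕ => Bool × Ω)
        ((jointWeight c ν₀ ν₁ univ)⁻¹ • jointWeight c ν₀ ν₁)
        (fun n : ℕ => (switchKernel κF κR c W s e ∘ₖ levelKernel T₀ T₁).comap
          (fun hh : (j : ↥(Finset.Iic n)) → Bool × Ω => hh ⟨n, Finset.mem_Iic.2 le_rfl⟩)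
          (measurable_pi_apply _))
      {z | η ≤ |c - Real.log
          ((∑ i ∈ range n, (targetLevel Ω).indicator (1 : Bool × Ω → ℝ) (z i)) / n /
            (1 - (∑ i ∈ range n, (targetLevel Ω).indicator (1 : Bool × Ω → ℝ) (z i)) / n)) - ΔF|} ≤
      ENNReal.ofReal (2 * (1 / 2 + (2 / ε.toReal - 1) / (1 - Real.sigmoid (c - ΔF))) *
        (Real.sigmoid (c - ΔF) * (1 - Real.sigmoid (c - ΔF))) / n /
        (min (Real.sigmoid (c - ΔF + η) - Real.sigmoid (c - ΔF))
          (Real.sigmoid (c - ΔF) - Real.sigmoid (c - ΔF - η))) ^ 2) := by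
  haveI := isMarkovKernel_switchKernel (κF := κF) (κR := κR) (c := c)
    h.measurable_W h.measurable_s h.measurable_e
  haveI := isMarkovKernel_levelKernel T₀ T₁
  have hδ : 0 < min (Real.sigmoid (c - ΔF + η) - Real.sigmoid (c - ΔF))
      (Real.sigmoid (c - ΔF) - Real.sigmoid (c - ΔF - η)) :=
    lt_min (sub_pos.2 (Real.sigmoid_lt (by linarith))) (sub_pos.2 (Real.sigmoid_lt (by linarith)))
  refine le_trans (measure_mono fun z hz => ?_)
    (h.ncmc_occupancy_deviation_le_of_sq h0 h1 hT₀ hT₁ hε hD hΔF hn hδ)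
  simp only [Set.mem_setOf_eq] at hz ⊢
  refine le_abs_sub_of_le_abs_logit_sub ?_
  rwa [show c - Real.log ((∑ i ∈ range n, (targetLevel Ω).indicator (1 : Bool × Ω → ℝ) (z i)) / n /
      (1 - (∑ i ∈ range n, (targetLevel Ω).indicator (1 : Bool × Ω → ℝ) (z i)) / n)) - ΔF =
      c - ΔF - Real.log ((∑ i ∈ range n, (targetLevel Ω).indicator (1 : Bool × Ω → ℝ) (z i)) / n /
      (1 - (∑ i ∈ range n, (targetLevel Ω).indicator (1 : Bool × Ω → ℝ) (z i)) / n)) by ring] at hz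

end ErrorBars

end Summit.Ventures.LatticeQCDFlow.Exactness.GeneralNCMC
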